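/-
Origin: expansion seat `planner-pub-hodgecm-toy-g2-0`, handover #23 2026-08-18T08:49:57Z (`HOME/pub-hodgecm-toy-g2/lean/ToyG2/HodgeRieszFree.lean`, md5 6e26f436, 213 lines);
landed by the gen-7 packager in gate run 27 as `HodgeCM/Model/ToyG2/HodgeRieszFree.lean` (import ^import ToyG2\.→import HodgeCM.Model.ToyG2. ×1).
-/
/-
# HodgeCM.Model.ToyG2.HodgeRieszFree — `HodgeRiesz` for block-free objects (G3, abelian case)

Generation 2 of the `pub-hodgecm-toy` lineage (seat `planner-pub-hodgecm-toy-g2-0`), DESIGN.md §9 (G3).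

For a BLOCK-FREE good object `X` ("abelian variety", `H^•(X) = ⋀^• H¹`) every rational functional
`lam : ⋀⁴ H¹(X) → ℚ` of Hodge type (2,2) is `y ↦ tr_X (y ∧ c)` for a (unique) RATIONAL HODGE CLASS `c` of type
`(dim X − 2, dim X − 2)`:

* representability: the trace pairing of a block-free object is perfect (`RadicalFree.lean`,
  tree `HodgeCM.Toy.Star.W_flip_bijective`);
* Hodge-ness of the representative, by UNIQUENESS OVER `ℂ`: the complexified identity
  `lam_ℂ(Y) = tr_ℂ(Y ∧ c_ℂ)` (checked on rational basis families, `Basis.ext_alternating`), the types of `lam`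
  (2,2) and of `tr_X` (dim, dim) (`trType_of_good`) and `wt (Y ∧ C) = wt Y ∧ wt C` give
  `tr_ℂ(Y ∧ (wt₂ c_ℂ − 2^{dim−2} c_ℂ)) = 0` for all `Y`, hence `wt₂ c_ℂ = 2^{dim−2} c_ℂ` by perfectness over `ℂ`
  (`Star.W_flip_injective` for the complexified space), i.e. `c` is a Hodge class
  (`Obj.mem_hodgeClasses_of_wt_two`, `HodgeWeight.lean`).

Main results: `hodgeRiesz_of_isBlockFree`, `hodgeRiesz_cmObj₂`; tools `baseC_theta_one_tmul`,
`wedge_theta_one_tmul` (Θ is multiplicative on rational classes), `eq_zero_of_forall_wedge` (right-perfectness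
with respect to any nonzero top-degree functional, any field).
-/
import Mathlib
import Summits.HodgeConjecture.HodgeCM.Model.ToyG2.RadicalFree

namespace HodgeCM.ToyG2

open HodgeCM.Toy HodgeCM.Toy.CMPresentation
open Literature.AlgebraicGeometry.Motives
open scoped TensorProduct
open exteriorPower Obj₂

noncomputable section

/-! ### §1 Complexification of rational classes -/

section Cx

variable (A : Obj)

/-- `baseC φ` evaluated on the complexification `Θ (1 ⊗ x)` of a rational class is `φ x` -/
lemma baseC_theta_one_tmul {k : ℕ} (φ : (⋀[ℚ]^k A.L) →ₗ[ℚ] ℚ) (x : ⋀[ℚ]^k A.L) :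
    baseC A φ (A.Θ k ((1 : ℂ) ⊗ₜ[ℚ] x)) = (φ x : ℂ) := by
  simp only [baseC, LinearMap.coe_comp, Function.comp_apply, LinearEquiv.coe_coe,
    LinearEquiv.symm_apply_apply, LinearMap.baseChange_tmul,
    TensorProduct.AlgebraTensorModule.rid_tmul, Rat.smul_one_eq_cast]

/-- `Θ` is multiplicative on rational classes -/
lemma wedge_theta_one_tmul {i j : ℕ} (y : ⋀[ℚ]^i A.L) (c : ⋀[ℚ]^j A.L) :
    wedge ℂ A.LC i j (A.Θ i ((1 : ℂ) ⊗ₜ[ℚ] y)) (A.Θ j ((1 : ℂ) ⊗ₜ[ℚ] c))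
      = A.Θ (i + j) ((1 : ℂ) ⊗ₜ[ℚ] wedge ℚ A.L i j y c) := by
  apply Subtype.ext
  simp only [BC.thetaEquiv_apply, BC.theta_tmul, one_smul, wedge_coe]
  exact (BC.thetaLin_wedge ℚ ℂ A.L i j y c).symm

/-- a complex pure wedge of rational vectors is the complexification of the rational pure wedge -/
lemma ιMulti_one_tmul {k : ℕ} (v : Fin k → A.L) :
    ιMulti ℂ k (fun i => (1 : ℂ) ⊗ₜ[ℚ] v i) = A.Θ k ((1 : ℂ) ⊗ₜ[ℚ] ιMulti ℚ k v) :=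
  ((A.Θ k).symm_apply_eq).1 (theta_symm_ιMulti_tmul A v)

/-- the complexified form on (complex pure wedge of rational vectors) ∧ (complexified rational class) -/
lemma baseC_wedge_ιMulti_theta {i j : ℕ} (φ : (⋀[ℚ]^(i + j) A.L) →ₗ[ℚ] ℚ) (v : Fin i → A.L)
    (c : ⋀[ℚ]^j A.L) :
    baseC A φ (wedge ℂ A.LC i j (ιMulti ℂ i (fun t => (1 : ℂ) ⊗ₜ[ℚ] v t)) (A.Θ j ((1 : ℂ) ⊗ₜ[ℚ] c)))
      = (φ (wedge ℚ A.L i j (ιMulti ℚ i v) c) : ℂ) := by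
  have h1 := ιMulti_one_tmul A v
  have h2 := wedge_theta_one_tmul A (ιMulti ℚ i v) c
  have h3 := baseC_theta_one_tmul A φ (wedge ℚ A.L i j (ιMulti ℚ i v) c)
  rw [← h3, ← h2, ← h1]

end Cx

/-! ### §2 Top-degree functionals over any field -/

section TopField

variable {R V : Type*} [Field R] [AddCommGroup V] [Module R V] [FiniteDimensional R V] {k l : ℕ}
  (hV : Module.finrank R V = k + l)

/-- (Ported verbatim from the HodgeCMPerL package; no docstring in the source.) -/
lemma apply_eq_lam_mul' (φ : (⋀[R]^(k + l) V) →ₗ[R] R) (z : ⋀[R]^(k + l) V) :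
    φ z = Star.lam hV z * φ (Star.vol hV) := by
  conv_lhs => rw [Star.eq_lam_smul_vol hV z]
  rw [map_smul, smul_eq_mul]

/-- (Ported verbatim from the HodgeCMPerL package; no docstring in the source.) -/
lemma vol_apply_ne_zero {φ : (⋀[R]^(k + l) V) →ₗ[R] R} (hφ : φ ≠ 0) : φ (Star.vol hV) ≠ 0 := by
  intro h0
  apply hφ
  refine LinearMap.ext fun z => ?_
  rw [apply_eq_lam_mul' hV φ z, h0, mul_zero, LinearMap.zero_apply]

include hV in
/-- **right-perfectness**: if `φ (y ∧ d) = 0` for all `y`, for one nonzero top functional `φ`, then `d = 0` -/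
lemma eq_zero_of_forall_wedge {φ : (⋀[R]^(k + l) V) →ₗ[R] R} (hφ : φ ≠ 0) (d : ⋀[R]^l V)
    (h : ∀ y : ⋀[R]^k V, φ (wedge R V k l y d) = 0) : d = 0 := by
  apply Star.W_flip_injective hV
  rw [map_zero]
  refine LinearMap.ext fun y => ?_
  rw [LinearMap.flip_apply, Star.W_apply, LinearMap.zero_apply]
  have h1 := h y
  rw [apply_eq_lam_mul' hV φ] at h1
  exact (mul_eq_zero.1 h1).resolve_right (vol_apply_ne_zero hV hφ)

end TopField

/-! ### §3 `HodgeRiesz` for block-free objects -/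

set_option maxHeartbeats 800000 in
/-- **G3, abelian case.** -/
theorem hodgeRiesz_of_isBlockFree {X : Obj₂} (hX : X.IsBlockFree) : HodgeRiesz X := by
  intro lam hlam _hrad
  by_cases h2 : 2 ≤ X.dim
  swap
  · have hlt : Module.finrank ℚ X.L < 4 := by
      rw [← two_mul_dim_eq_finrank hX]
      omega
    haveI := subsingleton_extPow_of_finrank_lt hlt
    refine ⟨0, Submodule.zero_mem _, fun y => ?_⟩
    simp only [Subsingleton.elim y 0, map_zero]
  -- numerology
  have h4m : 4 + 2 * (X.dim - 2) = 2 * X.dim := by omega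
  have hV : Module.finrank ℚ X.L = 4 + 2 * (X.dim - 2) := by rw [← two_mul_dim_eq_finrank hX, h4m]
  have hsd : sdeg X.s X.leaf = 4 + 2 * (X.dim - 2) := by rw [sdeg_eq, h4m]
  have hne : trOf X (4 + 2 * (X.dim - 2)) ≠ 0 := by
    have h := trOf_sdeg_ne_zero (good_of_isBlockFree hX)
    rwa [hsd] at h
  have hμ0 : trOf X (4 + 2 * (X.dim - 2)) (Star.vol hV) ≠ 0 := vol_apply_ne_zero hV hne
  -- Step 1: representability over ℚ
  obtain ⟨c, hc⟩ := (Star.W_flip_bijective hV).2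
    ((trOf X (4 + 2 * (X.dim - 2)) (Star.vol hV))⁻¹ • lam)
  have hrep : ∀ y, lam y = trOf X (4 + 2 * (X.dim - 2)) (wedge ℚ X.L 4 (2 * (X.dim - 2)) y c) := by
    intro y
    have h1 := LinearMap.congr_fun hc y
    rw [LinearMap.flip_apply, Star.W_apply, LinearMap.smul_apply, smul_eq_mul] at h1
    rw [apply_eq_lam_mul' hV (trOf X (4 + 2 * (X.dim - 2))), h1, mul_comm, ← mul_assoc,
      mul_inv_cancel₀ hμ0, one_mul]
  refine ⟨c, ?_, hrep⟩
  -- Step 2: the representative is a Hodge class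
  have hVC : Module.finrank ℂ X.toObj.LC = 4 + 2 * (X.dim - 2) := by
    haveI : Module.Free ℚ X.L := Module.Free.of_divisionRing ℚ _
    rw [Module.finrank_baseChange]
    exact hV
  have hneC : baseC X.toObj (trOf X (4 + 2 * (X.dim - 2))) ≠ 0 := by
    obtain ⟨x, hx⟩ : ∃ x, trOf X (4 + 2 * (X.dim - 2)) x ≠ 0 := by
      by_contra h'
      push Not at h'
      exact hne (LinearMap.ext fun x => h' x)
    intro h0
    have h1 := baseC_theta_one_tmul X.toObj (trOf X (4 + 2 * (X.dim - 2))) x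
    rw [h0, LinearMap.zero_apply] at h1
    exact hx (by exact_mod_cast h1.symm)
  -- (I) the complexified identity
  have hI : ∀ Y : ⋀[ℂ]^4 X.toObj.LC, baseC X.toObj lam Y
      = baseC X.toObj (trOf X (4 + 2 * (X.dim - 2)))
          (wedge ℂ X.toObj.LC 4 (2 * (X.dim - 2)) Y
            (X.toObj.Θ (2 * (X.dim - 2)) ((1 : ℂ) ⊗ₜ[ℚ] c))) := by
    suffices h : baseC X.toObj lam = baseC X.toObj (trOf X (4 + 2 * (X.dim - 2))) ∘ₗ
        (wedge ℂ X.toObj.LC 4 (2 * (X.dim - 2))).flip (X.toObj.Θ (2 * (X.dim - 2)) ((1 : ℂ) ⊗ₜ[ℚ] c)) by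
      intro Y
      rw [h]
      rfl
    haveI : Module.Free ℚ X.L := Module.Free.of_divisionRing ℚ _
    let bQ := Module.finBasis ℚ X.L
    refine exteriorPower.linearMap_ext ?_
    refine Module.Basis.ext_alternating (Algebra.TensorProduct.basis ℂ bQ) fun g _ => ?_
    simp only [LinearMap.compAlternatingMap_apply, LinearMap.coe_comp, Function.comp_apply,
      LinearMap.flip_apply, Algebra.TensorProduct.basis_apply]
    exact (baseCA_tmul X.toObj lam (fun i => bQ (g i))).trans
      (((congrArg (fun q : ℚ => (q : ℂ)) (hrep _))).trans
        (baseC_wedge_ιMulti_theta X.toObj _ (fun i => bQ (g i)) c).symm)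
  -- types
  have htr := trType_of_good (good_of_isBlockFree hX)
  have h1 : ∀ W, baseC X.toObj (trOf X (4 + 2 * (X.dim - 2))) (X.toObj.wt 2 (4 + 2 * (X.dim - 2)) W)
      = (2 : ℂ) ^ X.dim * baseC X.toObj (trOf X (4 + 2 * (X.dim - 2))) W := fun W => by
    have h := LinearMap.congr_fun (htr (4 + 2 * (X.dim - 2)) 2) W
    rw [LinearMap.comp_apply, LinearMap.smul_apply, smul_eq_mul] at h
    exact h
  have hl : ∀ W, baseC X.toObj lam (X.toObj.wt 2 4 W) = (2 : ℂ) ^ 2 * baseC X.toObj lam W := fun W => by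
    have h := LinearMap.congr_fun (hlam 2) W
    rw [LinearMap.comp_apply, LinearMap.smul_apply, smul_eq_mul] at h
    exact h
  have hY : ∀ Y : ⋀[ℂ]^4 X.toObj.LC, X.toObj.wt 2 4 (X.toObj.wt 2⁻¹ 4 Y) = Y := fun Y => by
    rw [← LinearMap.comp_apply, Obj.wt_mul, mul_inv_cancel₀ two_ne_zero, Obj.wt_one,
      LinearMap.id_apply]
  -- the key identity: tr_ℂ (Y ∧ wt₂ C) = 2^{dim-2} tr_ℂ (Y ∧ C)
  have hkey : ∀ Y : ⋀[ℂ]^4 X.toObj.LC,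
      baseC X.toObj (trOf X (4 + 2 * (X.dim - 2)))
          (wedge ℂ X.toObj.LC 4 (2 * (X.dim - 2)) Y
            (X.toObj.wt 2 (2 * (X.dim - 2)) (X.toObj.Θ (2 * (X.dim - 2)) ((1 : ℂ) ⊗ₜ[ℚ] c))))
        = (2 : ℂ) ^ (X.dim - 2) * baseC X.toObj (trOf X (4 + 2 * (X.dim - 2)))
          (wedge ℂ X.toObj.LC 4 (2 * (X.dim - 2)) Y
            (X.toObj.Θ (2 * (X.dim - 2)) ((1 : ℂ) ⊗ₜ[ℚ] c))) := by
    intro Y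
    have hpow : (2 : ℂ) ^ X.dim = (2 : ℂ) ^ (X.dim - 2) * (2 : ℂ) ^ 2 := by
      rw [← pow_add, Nat.sub_add_cancel h2]
    conv_lhs => rw [← hY Y, ← Obj.wt_wedge, h1, ← hI, hpow, mul_assoc, ← hl, hY Y, hI]
  -- perfectness over ℂ
  have hD : X.toObj.wt 2 (2 * (X.dim - 2)) (X.toObj.Θ (2 * (X.dim - 2)) ((1 : ℂ) ⊗ₜ[ℚ] c))
      - (2 : ℂ) ^ (X.dim - 2) • X.toObj.Θ (2 * (X.dim - 2)) ((1 : ℂ) ⊗ₜ[ℚ] c) = 0 := by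
    refine eq_zero_of_forall_wedge hVC hneC _ fun Y => ?_
    rw [map_sub, map_smul, map_sub, map_smul, hkey Y, smul_eq_mul, sub_self]
  have hwt := sub_eq_zero.1 hD
  have hof : (HodgeStructure.ofRat c : ℂ ⊗[ℚ] ↥(⋀[ℚ]^(2 * (X.dim - 2)) X.L)) = (1 : ℂ) ⊗ₜ[ℚ] c := rfl
  have hc : c ∈ (X.toObj.hodgeStructure (2 * (X.dim - 2))).hodgeClasses ((X.dim - 2 : ℕ) : ℤ) :=
    X.toObj.mem_hodgeClasses_of_wt_two (m := X.dim - 2) (v := c) (by rw [hof]; exact hwt)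
  exact hc

/-- in particular for CM abelian varieties -/
theorem hodgeRiesz_cmObj₂ (K : CMField) (Φ : CMType K) : HodgeRiesz (cmObj₂ K Φ) :=
  hodgeRiesz_of_isBlockFree (isBlockFree_cmObj₂ K Φ)

end

end HodgeCM.ToyG2
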